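import Summits.BirchSwinnertonDyer.BirchSwinnertonDyer.Theorems.PrintCFramBottomClassIndexLawFiveLeSelmerDevissageCountRationalAligned
import Literature.NumberTheory.EllipticCurves.LocalKummerMap
import Literature.NumberTheory.EllipticCurves.StrictSelmerRankOne
import HarnessLib

/-!
# Route `PrintCFram`, crux C2 `BottomClassIndexLawFiveLe` (stmt-BirchSwinnertonDyer-20372), line
# `eisenstein-resource-bdp-line` (registry v19, stub B1 `stub_bsdp_of_classFactor`): **THE LOCAL KUMMER CRITERION FOR
# ALIGNED / TRANSVERSE** — the case split of the Selmer count read on `p`-division points of `ℚ_p`-POINTS ONLY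
# (cell `bsd-print-cfram`, width seat `bsd-line-cfram-p1-w6` g4; helper `--supports` 20372; 0 defs, 0 facts, 0 sorry)

HONEST FRAMING. Nothing about BSD is proved here and no stub is closed. Sequel of w2 g9's
`…SelmerDevissageCountRationalAligned` (ALIGNED / TRANSVERSE counts and their dichotomy on `Sel_p(W/ℚ)`), same
notation: `Γ = Γ_ℚ`, `M = W[p]`, `Φ ≤ M` a stable subgroup (`X2` `StableSubgroup`; sub `Φ.Sub`, quotient `Φ.Quot`),
`v` the place above `p`, `D_p = decomp v`, `E = ℚ_v = v.adicCompletion ℚ`, `Γ_v = Γ_{ℚ_v}`, `W(K̄_v) = localPoints W ℚ_v`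
with its `Γ_v`-action, `ι = pointsMap W ℚ_v : W(ℚ̄) → W(K̄_v)` (the chosen embedding), and
`j : W(ℚ_v) → W(K̄_v)` the inclusion of the rational local points (`Affine.Point.map` along `ℚ_v → K̄_v`).
There (w2 g9 notes §3, LEAD g10 report §2(a)–(b)) ALIGNED / TRANSVERSE were HYPOTHESES on all Selmer cocycles
restricted to `D_p`; the decision «which case holds for a given member» was left to «kit/LMFDB per class; a kernel
proof needs isogeny pull-backs of minimal differentials». This file proves the Galois-cohomological half of that
decision: both cases, their dichotomy and their exclusivity are statements about `p`-th ROOTS OF `ℚ_v`-POINTS.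

A `p`-th root `R ∈ W(K̄_v)` of a rational local point `P ∈ W(ℚ_v)` (`p • R = j P`) is **`Φ`-adapted** when its
Kummer cocycle is `Φ`-valued: `σ • R − R ∈ ι(Φ)` for every `σ ∈ Γ_v` (for the isogeny `φ : W → W' = W/Φ` this says
`P ∈ φ̂(W'(ℚ_v))`; no isogenous curve and no local points map of an isogeny is needed to state it). Write
**(LA)** «every `P ∈ W(ℚ_v)` has a `Φ`-adapted `p`-th root» (= `W(ℚ_v) = φ̂W'(ℚ_v) + pW(ℚ_v)`) and
**(LT)** «every `P ∈ W(ℚ_v)` with a `Φ`-adapted `p`-th root is `p`-divisible in `W(ℚ_v)`» (= `φ̂W'(ℚ_v) ⊆ pW(ℚ_v)`).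

* §1 **`aligned_of_forall_exists_adaptedRoot`** — (LA) ⟹ ALIGNED (every push-forward `Φ.proj ∘ z` of a Selmer
  cocycle is a coboundary on `D_p`): the Selmer condition at `v` makes `z|_{Γ_v}` the Kummer cocycle of a root `a` of a
  rational local point; a `Φ`-adapted root of the same point differs from `a` by a `p`-torsion point `t`, algebraic by
  `torsionPointsMap_bijective`, so `Φ.proj ∘ z = ∂(Φ.proj t)` on `D_p`. **`transverse_of_forall_exists_adaptedRoot_imp`**
  — `Φ.Quot^{D_p} = 0` ∧ (LT) ⟹ TRANSVERSE (every `w : Γ → Φ.Sub` whose push-forward has a Selmer class is a coboundary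
  on `D_p`): the local root is `Φ`-adapted, so its `p`-th power is `p`-divisible, `Φ.incl ∘ w|_{Γ_v} = ∂t` with
  `t ∈ W[p]`, and `Φ.proj t` is `D_p`-fixed, whence `t ∈ Φ`.
* §2 **`forall_exists_adaptedRoot_or_forall_imp`** — THE LOCAL DICHOTOMY: `W(ℚ_v)[p] = 0` ⟹ (LA) ∨ (LT)
  (`W(ℚ_v)/pW(ℚ_v)` has prime order `p`, Milne I Lemma 3.3 = tree `card_quotient_range_nsmul_adicCompletion`; the
  points with a `Φ`-adapted root form a subgroup containing `pW(ℚ_v)`). **`not_forall_exists_adaptedRoot_and`** —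
  EXCLUSIVITY: never both (`W(ℚ_v)` is not `p`-divisible: `[W(ℚ_v) : pW(ℚ_v)] = #W(ℚ_v)[p] · p`). So with w2 g9's
  counts the member is ALIGNED in case (LA), TRANSVERSE in case (LT), and EXACTLY ONE case holds — decided by `W(ℚ_v)`
  and its `p`-division points (the Kodaira reading «(LT) ⟺ v_p(Δ_min(W)) < 6», Gealy–Klagsbrun 2017 Thm. 1 with
  Schaefer's local index, is NOT claimed). **`aligned_or_transverse_selmerGroup_local`** re-derives w2 g9's dichotomy.
  The link with the crux's LEVEL binder is the sequel `…SelmerDevissageLocalCriterionLevel`.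

THEOREMS ONLY; no definition, no named fact, no `sorry`. BSD is not proved by any of this; no summit statement is
proved by this seat. References: [SilvermanAEC2009] VIII.§2 (Kummer pairing), X.§4 (diagram (**), Cor. 4.4,
Ex. 4.8, Rem. 4.7), Cor. III.6.4(b); [MilneADT2006] I Lemma 3.3; [SerreGaloisCohomology1997] I.§5.1, II.§1.1;
[GreenbergLNM1716] §3; seat notes w2g9 §3, LEAD g10 report §2(a)–(b).
-/

set_option autoImplicit false
-- `…BirchSwinnertonDyer.BirchSwinnertonDyer.Theorems…` is the problem's mandated namespace (D-0017).
set_option linter.dupNamespace false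

noncomputable section

open scoped Classical

namespace Summit.BirchSwinnertonDyer.BirchSwinnertonDyer.Theorems.PrintCFram.SelmerCount

open NumberField IsDedekindDomain Field WeierstrassCurve
open Literature.NumberTheory.EllipticCurves Literature.NumberTheory.GaloisRepresentations
  Literature.NumberTheory.EllipticCurves.GreenbergSelmer
open Summit.BirchSwinnertonDyer.BirchSwinnertonDyer.Theorems.PrintCFram.LevelDictionary
open Summit.BirchSwinnertonDyer.Rank1Residual.X2.ResidualDevissageModules

variable (W : WeierstrassCurve ℚ) [W.IsElliptic]

/-! ## §0 Plumbing: rational local points inside `W(K̄_v)` -/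

section Plumbing

variable {p : ℕ} [hp : Fact p.Prime] (v : HeightOneSpectrum (𝓞 ℚ))

omit [W.IsElliptic] in
/-- A rational local point `j R`, `R ∈ W(ℚ_v)`, is fixed by `Γ_v = Gal(K̄_v/ℚ_v)` (the action is on coordinates and
the coordinates of `j R` lie in `ℚ_v`). [folklore] -/
theorem smul_eq_of_eq_map_toAlgHom (E : Type) [Field E] [Algebra ℚ E] (τ : absoluteGaloisGroup E)
    (R : (W.baseChange E).toAffine.Point) (X : localPoints W E)
    (hX : X = Affine.Point.map (W' := W) (IsScalarTower.toAlgHom ℚ E (AlgebraicClosure E)) R) :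
    τ • X = X := by
  subst hX
  rw [localPoints.smul_def]
  change Affine.Point.map _ (Affine.Point.map _ R) = Affine.Point.map _ R
  rw [Affine.Point.map_map]
  refine congrArg (fun f ↦ Affine.Point.map (W' := W) f R) ?_
  ext x
  exact AlgEquiv.commutes (show AlgebraicClosure E ≃ₐ[E] AlgebraicClosure E from τ) x

/-- **All `p`-torsion of `W(K̄_v)` is algebraic**: a `p`-torsion local point is `ι t` for some `t ∈ W[p](ℚ̄)`
(`torsionPointsMap_bijective`, Silverman III.6.4(b)). [cite: SilvermanAEC2009, Cor. III.6.4(b)] -/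
theorem exists_geomTorsion_pointsMap_eq {T : localPoints W (v.adicCompletion ℚ)} (hT : (p : ℤ) • T = 0) :
    ∃ t : geomTorsion W (p : ℤ), pointsMap W (v.adicCompletion ℚ) (t : geomPoints W) = T := by
  have hp0 : (p : ℤ) ≠ 0 := by exact_mod_cast hp.out.ne_zero
  obtain ⟨t, ht⟩ := (torsionPointsMap_bijective_of_ne_zero W (p : ℤ) (E := v.adicCompletion ℚ) hp0).2
    ⟨T, (Submodule.mem_torsionBy_iff _ _).mpr hT⟩
  refine ⟨t, ?_⟩
  have h := congrArg Subtype.val ht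
  rwa [coe_torsionPointsMap] at h

omit [W.IsElliptic] hp in
/-- **The Selmer condition at `v`, cocycle form.** A continuous crossed homomorphism `z : Γ_ℚ → W[p]` whose class is
Selmer is, on `Γ_v`, the Kummer cocycle of a local point: `ι(z(res σ)) = σ • a − a` for some `a ∈ W(K̄_v)`; and then
`p • a = j P` for a rational local point `P ∈ W(ℚ_v)` (Galois descent over `ℚ_v`). This is the row
`0 → W(ℚ_v)/p → H¹(Γ_v, W[p]) → H¹(Γ_v, W)` of Silverman X.§4 diagram (**).
[cite: SilvermanAEC2009, X.§4 (diagram (**) before Thm. 4.2)] -/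
theorem exists_root_of_mem_selmerGroup
    (z : contOneCocycles (discreteTopRep (absoluteGaloisGroup ℚ) (geomTorsion W (p : ℤ))))
    (hz : oneCocycleClass _ z ∈ selmerGroup W (p : ℤ)) :
    ∃ (a : localPoints W (v.adicCompletion ℚ)) (P : (W.baseChange (v.adicCompletion ℚ)).toAffine.Point),
      (∀ σ : absoluteGaloisGroup (v.adicCompletion ℚ),
        pointsMap W (v.adicCompletion ℚ) ((z.1 (resGal (K := ℚ) (v.adicCompletion ℚ) σ) : geomPoints W)) =
          σ • a - a) ∧
      (p : ℤ) • a = Affine.Point.map (W' := W)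
        (IsScalarTower.toAlgHom ℚ (v.adicCompletion ℚ) (AlgebraicClosure (v.adicCompletion ℚ))) P := by
  have hloc : oneCocycleClass _ z ∈ selmerLocalKer W (v.adicCompletion ℚ) (p : ℤ) := ((mem_selmerGroup_iff W (p : ℤ) _).1 hz).1 v
  unfold selmerLocalKer at hloc
  rw [oneCocycleClass_mem_resKer_iff] at hloc
  obtain ⟨a, ha⟩ := hloc
  have ha' : ∀ σ : absoluteGaloisGroup (v.adicCompletion ℚ),
      pointsMap W (v.adicCompletion ℚ) ((z.1 (resGal (K := ℚ) (v.adicCompletion ℚ) σ) : geomPoints W)) =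
        σ • a - a := fun σ ↦ ha σ
  -- `p • a` is `Γ_v`-fixed
  have hfix : ∀ σ : absoluteGaloisGroup (v.adicCompletion ℚ), σ • ((p : ℤ) • a) = (p : ℤ) • a := by
    intro σ
    have h0 : (p : ℤ) • ((z.1 (resGal (K := ℚ) (v.adicCompletion ℚ) σ) : geomPoints W)) = 0 :=
      (mem_geomTorsion_iff W (p : ℤ) _).mp (z.1 (resGal (K := ℚ) (v.adicCompletion ℚ) σ)).2
    have h1 : (p : ℤ) • (σ • a - a) = 0 := by rw [← ha' σ, ← map_zsmul, h0, map_zero]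
    rw [smul_comm, ← sub_eq_zero, ← zsmul_sub, h1]
  obtain ⟨P, hP⟩ := @exists_map_eq_of_forall_smul_localPoints_eq ℚ _ W (v.adicCompletion ℚ) _ _
    (@PerfectField.ofCharZero (v.adicCompletion ℚ) _
      (charZero_of_injective_algebraMap (algebraMap ℚ (v.adicCompletion ℚ)).injective)) _ hfix
  exact ⟨a, P, ha', hP.symm⟩

end Plumbing

/-! ## §1 The two criteria -/

section Criteria

variable {p : ℕ} [hp : Fact p.Prime] (v : HeightOneSpectrum (𝓞 ℚ))
  (Φ : StableSubgroup (absoluteGaloisGroup ℚ) (geomTorsion W (p : ℤ)))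

/-- **(LA) ⟹ ALIGNED.** `W/ℚ` elliptic, `p` prime, `v` a finite place, `Φ ≤ W[p]` a stable subgroup. Suppose every
rational local point `P ∈ W(ℚ_v)` has a `Φ`-ADAPTED `p`-th root: `R ∈ W(K̄_v)` with `p • R = j P` and
`σ • R − R ∈ ι(Φ)` for all `σ ∈ Γ_v` (= «`W(ℚ_v) = φ̂W'(ℚ_v) + pW(ℚ_v)`» for the isogeny with kernel `Φ`). Then
`W` is ALIGNED at `v` along `Φ` in the sense of `SelmerCount.natCard_selmerGroup_le_of_aligned`: for every
continuous crossed homomorphism `z : Γ_ℚ → W[p]` with Selmer class, `Φ.proj ∘ z` is a coboundary on `D_p = decomp v`.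
[cite: SilvermanAEC2009, X.§4 (diagram (**), Rem. 4.7)] [cite: SerreGaloisCohomology1997, I.§5.1 and II.§1.1] -/
theorem aligned_of_forall_exists_adaptedRoot
    (hLA : ∀ P : (W.baseChange (v.adicCompletion ℚ)).toAffine.Point,
      ∃ R : localPoints W (v.adicCompletion ℚ),
        (p : ℤ) • R = Affine.Point.map (W' := W)
          (IsScalarTower.toAlgHom ℚ (v.adicCompletion ℚ) (AlgebraicClosure (v.adicCompletion ℚ))) P ∧
        ∀ σ : absoluteGaloisGroup (v.adicCompletion ℚ), ∃ t ∈ Φ.toAddSubgroup,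
          σ • R - R = pointsMap W (v.adicCompletion ℚ) (t : geomPoints W))
    (z : contOneCocycles (discreteTopRep (absoluteGaloisGroup ℚ) (geomTorsion W (p : ℤ))))
    (hz : oneCocycleClass _ z ∈ selmerGroup W (p : ℤ)) :
    ∃ q : Φ.Quot, ∀ g ∈ decomp v, Φ.proj (z.1 g) = g • q - q := by
  obtain ⟨a, P, ha, haP⟩ := exists_root_of_mem_selmerGroup W v z hz
  obtain ⟨R, hR, hRΦ⟩ := hLA P
  -- `T = a − R` is `p`-torsion, hence algebraic
  obtain ⟨t₀, ht₀⟩ := exists_geomTorsion_pointsMap_eq W v (T := a - R) (by rw [zsmul_sub, haP, hR, sub_self])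
  refine ⟨Φ.proj t₀, fun g hg ↦ ?_⟩
  obtain ⟨σ, rfl⟩ := (mem_decomp_iff v g).1 hg
  obtain ⟨t, htΦ, ht⟩ := hRΦ σ
  -- `z(res σ) = t + (σ t₀ − t₀)` in `W[p]`
  have key : z.1 (resGal (K := ℚ) (v.adicCompletion ℚ) σ) =
      t + (resGal (K := ℚ) (v.adicCompletion ℚ) σ • t₀ - t₀) := by
    apply Subtype.ext
    apply pointsMapOfEmb_injective W (closureEmb (K := ℚ) (v.adicCompletion ℚ))
    change pointsMap W (v.adicCompletion ℚ) _ = pointsMap W (v.adicCompletion ℚ) _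
    rw [ha σ, AddSubgroup.coe_add, AddSubgroup.coe_sub,
      Literature.NumberTheory.EllipticCurves.AddSubgroup.torsionBy.coe_smul, map_add, map_sub,
      pointsMap_smul, ht₀, ← ht, smul_sub]
    abel
  have hpt : Φ.proj t = 0 := (QuotientAddGroup.eq_zero_iff _).mpr htΦ
  rw [resGal_eq_absGaloisRestrict] at key
  rw [key, map_add, map_sub, hpt, zero_add, Φ.proj_smul]

/-- **`Φ.Quot^{D_p} = 0` ∧ (LT) ⟹ TRANSVERSE.** Same setting; assume `Φ.Quot` has no non-zero `D_p`-fixed element, and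
that every rational local point `P ∈ W(ℚ_v)` admitting a `Φ`-ADAPTED `p`-th root (`p • R = j P`, `σ • R − R ∈ ι(Φ)` on
`Γ_v`) is `p`-DIVISIBLE in `W(ℚ_v)` (= «`φ̂W'(ℚ_v) ⊆ pW(ℚ_v)`»). Then `W` is TRANSVERSE at `v` along `Φ` in the sense
of `SelmerCount.natCard_selmerGroup_le_of_transverse`: every continuous crossed homomorphism `w : Γ_ℚ → Φ` whose
push-forward `Φ.incl ∘ w` has Selmer class is a coboundary on `D_p`.
[cite: SilvermanAEC2009, X.§4 (diagram (**), Rem. 4.7)] [cite: SerreGaloisCohomology1997, I.§5.1 and II.§1.1] -/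
theorem transverse_of_forall_exists_adaptedRoot_imp
    (hQD : ∀ q : Φ.Quot, (∀ g ∈ decomp v, g • q = q) → q = 0)
    (hLT : ∀ P : (W.baseChange (v.adicCompletion ℚ)).toAffine.Point,
      (∃ R : localPoints W (v.adicCompletion ℚ),
        (p : ℤ) • R = Affine.Point.map (W' := W)
          (IsScalarTower.toAlgHom ℚ (v.adicCompletion ℚ) (AlgebraicClosure (v.adicCompletion ℚ))) P ∧
        ∀ σ : absoluteGaloisGroup (v.adicCompletion ℚ), ∃ t ∈ Φ.toAddSubgroup,
          σ • R - R = pointsMap W (v.adicCompletion ℚ) (t : geomPoints W)) →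
      ∃ S : (W.baseChange (v.adicCompletion ℚ)).toAffine.Point, p • S = P)
    (w : contOneCocycles (discreteTopRep (absoluteGaloisGroup ℚ) Φ.Sub))
    (hw : oneCocycleClass (discreteTopRep (absoluteGaloisGroup ℚ) (geomTorsion W (p : ℤ)))
      (contOneCocycles.pullback (ContinuousMonoidHom.id _)
        (resHomOfEquivariant (ContinuousMonoidHom.id _) Φ.incl Φ.incl_smul) w) ∈ selmerGroup W (p : ℤ)) :
    ∃ s : Φ.Sub, ∀ g ∈ decomp v, w.1 g = g • s - s := by
  obtain ⟨a, P, ha, haP⟩ := exists_root_of_mem_selmerGroup W v _ hw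
  have ha' : ∀ σ : absoluteGaloisGroup (v.adicCompletion ℚ),
      pointsMap W (v.adicCompletion ℚ) ((Φ.incl (w.1 (resGal (K := ℚ) (v.adicCompletion ℚ) σ)) : geomPoints W)) =
        σ • a - a := fun σ ↦ ha σ
  -- `a` is a `Φ`-adapted root of `P`, so `P = p • S`
  obtain ⟨S, hS⟩ := hLT P ⟨a, haP, fun σ ↦
    ⟨Φ.incl (w.1 (resGal (K := ℚ) (v.adicCompletion ℚ) σ)), (w.1 _).2, (ha' σ).symm⟩⟩
  -- `T = a − j S` is `p`-torsion, hence algebraic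
  set jS : localPoints W (v.adicCompletion ℚ) := Affine.Point.map (W' := W)
    (IsScalarTower.toAlgHom ℚ (v.adicCompletion ℚ) (AlgebraicClosure (v.adicCompletion ℚ))) S with hjS
  obtain ⟨t₀, ht₀⟩ := exists_geomTorsion_pointsMap_eq W v (T := a - jS) (by
    rw [zsmul_sub, haP, ← hS, map_nsmul, natCast_zsmul]
    exact sub_self _)
  have hSfix : ∀ σ : absoluteGaloisGroup (v.adicCompletion ℚ), σ • jS = jS := fun σ ↦
    smul_eq_of_eq_map_toAlgHom W (v.adicCompletion ℚ) σ S jS hjS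
  -- `Φ.incl (w (res σ)) = σ t₀ − t₀`
  have key : ∀ σ : absoluteGaloisGroup (v.adicCompletion ℚ),
      Φ.incl (w.1 (resGal (K := ℚ) (v.adicCompletion ℚ) σ)) = resGal (K := ℚ) (v.adicCompletion ℚ) σ • t₀ - t₀ := by
    intro σ
    apply Subtype.ext
    apply pointsMapOfEmb_injective W (closureEmb (K := ℚ) (v.adicCompletion ℚ))
    change pointsMap W (v.adicCompletion ℚ) _ = pointsMap W (v.adicCompletion ℚ) _
    rw [ha' σ, AddSubgroup.coe_sub, Literature.NumberTheory.EllipticCurves.AddSubgroup.torsionBy.coe_smul, map_sub,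
      pointsMap_smul, ht₀, smul_sub, hSfix]
    abel
  -- `Φ.proj t₀` is `D_p`-fixed, hence zero: `t₀ ∈ Φ`
  have hfixq : ∀ g ∈ decomp v, g • Φ.proj t₀ = Φ.proj t₀ := by
    intro g hg
    obtain ⟨σ, rfl⟩ := (mem_decomp_iff v g).1 hg
    have h := congrArg Φ.proj (key σ)
    rw [Φ.proj_incl, map_sub, Φ.proj_smul, resGal_eq_absGaloisRestrict] at h
    exact (sub_eq_zero.mp h.symm)
  have ht₀Φ : t₀ ∈ Φ.toAddSubgroup := (QuotientAddGroup.eq_zero_iff _).mp (hQD _ hfixq)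
  refine ⟨⟨t₀, ht₀Φ⟩, fun g hg ↦ ?_⟩
  obtain ⟨σ, rfl⟩ := (mem_decomp_iff v g).1 hg
  apply Φ.incl_injective
  have h := key σ
  rw [resGal_eq_absGaloisRestrict] at h
  rw [h, map_sub, Φ.incl_smul]
  rfl

end Criteria

/-! ## §2 The local dichotomy and its exclusivity -/

section Dichotomy

variable {p : ℕ} [hp : Fact p.Prime] (v : HeightOneSpectrum (𝓞 ℚ))
  (Φ : StableSubgroup (absoluteGaloisGroup ℚ) (geomTorsion W (p : ℤ)))

/-- **`[W(ℚ_v) : pW(ℚ_v)] = p` when `W(ℚ_v)[p] = 0`** (`v ∣ p`): Milne I Lemma 3.3 (tree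
`card_quotient_range_nsmul_adicCompletion`) with `#(ℤ_v/pℤ_v) = p`. [cite: MilneADT2006, I Lemma 3.3] -/
theorem index_range_nsmul_eq_prime (hpv : ((p : ℕ) : 𝓞 ℚ) ∈ v.asIdeal)
    (htors : Nat.card (nsmulAddMonoidHom p :
      (W.baseChange (v.adicCompletion ℚ)).toAffine.Point →+ _).ker = 1) :
    (nsmulAddMonoidHom p : (W.baseChange (v.adicCompletion ℚ)).toAffine.Point →+ _).range.index = p := by
  rw [AddSubgroup.index, W.card_quotient_range_nsmul_adicCompletion v hp.out.ne_zero, htors, one_mul,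
    natCard_adicCompletionIntegers_quot_span_prime hpv]

/-- **EXCLUSIVITY: (LA) and (LT) cannot both hold.** If every rational local point has a `Φ`-adapted `p`-th root AND
every point with such a root is `p`-divisible, then `W(ℚ_v) = pW(ℚ_v)`, contradicting
`[W(ℚ_v) : pW(ℚ_v)] = #W(ℚ_v)[p] · #(ℤ_v/pℤ_v) ≥ p` (Milne I Lemma 3.3). So for the pair `(W, Φ)` at most one of the
two local conditions holds. [cite: MilneADT2006, I Lemma 3.3] -/
theorem not_forall_exists_adaptedRoot_and (hpv : ((p : ℕ) : 𝓞 ℚ) ∈ v.asIdeal)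
    (hLA : ∀ P : (W.baseChange (v.adicCompletion ℚ)).toAffine.Point,
      ∃ R : localPoints W (v.adicCompletion ℚ),
        (p : ℤ) • R = Affine.Point.map (W' := W)
          (IsScalarTower.toAlgHom ℚ (v.adicCompletion ℚ) (AlgebraicClosure (v.adicCompletion ℚ))) P ∧
        ∀ σ : absoluteGaloisGroup (v.adicCompletion ℚ), ∃ t ∈ Φ.toAddSubgroup,
          σ • R - R = pointsMap W (v.adicCompletion ℚ) (t : geomPoints W))
    (hLT : ∀ P : (W.baseChange (v.adicCompletion ℚ)).toAffine.Point,
      (∃ R : localPoints W (v.adicCompletion ℚ),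
        (p : ℤ) • R = Affine.Point.map (W' := W)
          (IsScalarTower.toAlgHom ℚ (v.adicCompletion ℚ) (AlgebraicClosure (v.adicCompletion ℚ))) P ∧
        ∀ σ : absoluteGaloisGroup (v.adicCompletion ℚ), ∃ t ∈ Φ.toAddSubgroup,
          σ • R - R = pointsMap W (v.adicCompletion ℚ) (t : geomPoints W)) →
      ∃ S : (W.baseChange (v.adicCompletion ℚ)).toAffine.Point, p • S = P) :
    False := by
  haveI := W.finite_ker_nsmul_adicCompletion v hp.out.ne_zero
  have htop : (nsmulAddMonoidHom p : (W.baseChange (v.adicCompletion ℚ)).toAffine.Point →+ _).range = ⊤ := by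
    rw [AddSubgroup.eq_top_iff']
    intro P
    obtain ⟨S, hS⟩ := hLT P (hLA P)
    exact ⟨S, hS⟩
  have hidx := W.card_quotient_range_nsmul_adicCompletion v hp.out.ne_zero
  rw [← AddSubgroup.index, htop, AddSubgroup.index_top, natCard_adicCompletionIntegers_quot_span_prime hpv] at hidx
  have h1 : 1 ≤ Nat.card (nsmulAddMonoidHom p :
      (W.baseChange (v.adicCompletion ℚ)).toAffine.Point →+ _).ker := Nat.card_pos
  have : p ≤ 1 := by
    calc p = 1 * p := (one_mul p).symm
      _ ≤ Nat.card (nsmulAddMonoidHom p : (W.baseChange (v.adicCompletion ℚ)).toAffine.Point →+ _).ker * p :=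
          Nat.mul_le_mul_right p h1
      _ = 1 := hidx.symm
  exact absurd this (not_le.mpr hp.out.one_lt)

/-- **THE LOCAL DICHOTOMY: `W(ℚ_v)[p] = 0` ⟹ (LA) ∨ (LT).** If the rational local points have no `p`-torsion then
`W(ℚ_v)/pW(ℚ_v)` has prime order `p` (Milne I Lemma 3.3); so if SOME point `P₀ ∉ pW(ℚ_v)` has a `Φ`-adapted root
`R₀`, every `P = k • P₀ + p • S` has the `Φ`-adapted root `k • R₀ + j S` (the `Φ`-adapted roots form a subgroup of
`W(K̄_v)` containing `j(W(ℚ_v))`): either (LT) holds, or (LA) does. «Two lines in the plane `H¹(ℚ_v, W[p])`»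
(LEAD g10 report §2(a)), read on division points. [cite: MilneADT2006, I Lemma 3.3]
[cite: SilvermanAEC2009, X.§4 (diagram (**), Rem. 4.7)] -/
theorem forall_exists_adaptedRoot_or_forall_imp (hpv : ((p : ℕ) : 𝓞 ℚ) ∈ v.asIdeal)
    (htors : Nat.card (nsmulAddMonoidHom p :
      (W.baseChange (v.adicCompletion ℚ)).toAffine.Point →+ _).ker = 1) :
    (∀ P : (W.baseChange (v.adicCompletion ℚ)).toAffine.Point,
      ∃ R : localPoints W (v.adicCompletion ℚ),
        (p : ℤ) • R = Affine.Point.map (W' := W)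
          (IsScalarTower.toAlgHom ℚ (v.adicCompletion ℚ) (AlgebraicClosure (v.adicCompletion ℚ))) P ∧
        ∀ σ : absoluteGaloisGroup (v.adicCompletion ℚ), ∃ t ∈ Φ.toAddSubgroup,
          σ • R - R = pointsMap W (v.adicCompletion ℚ) (t : geomPoints W)) ∨
    (∀ P : (W.baseChange (v.adicCompletion ℚ)).toAffine.Point,
      (∃ R : localPoints W (v.adicCompletion ℚ),
        (p : ℤ) • R = Affine.Point.map (W' := W)
          (IsScalarTower.toAlgHom ℚ (v.adicCompletion ℚ) (AlgebraicClosure (v.adicCompletion ℚ))) P ∧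
        ∀ σ : absoluteGaloisGroup (v.adicCompletion ℚ), ∃ t ∈ Φ.toAddSubgroup,
          σ • R - R = pointsMap W (v.adicCompletion ℚ) (t : geomPoints W)) →
      ∃ S : (W.baseChange (v.adicCompletion ℚ)).toAffine.Point, p • S = P) := by
  set N : AddSubgroup (W.baseChange (v.adicCompletion ℚ)).toAffine.Point :=
    (nsmulAddMonoidHom p : (W.baseChange (v.adicCompletion ℚ)).toAffine.Point →+ _).range with hN
  rw [or_iff_not_imp_right]
  intro hnot
  push Not at hnot
  obtain ⟨P₀, ⟨R₀, hR₀, hR₀Φ⟩, hP₀⟩ := hnot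
  -- `P₀ ∉ pW(ℚ_v)` generates the quotient of prime order `p`
  have hidx : N.index = p := index_range_nsmul_eq_prime W v hpv htors
  haveI : Finite ((W.baseChange (v.adicCompletion ℚ)).toAffine.Point ⧸ N) := by
    refine Nat.finite_of_card_ne_zero ?_
    rw [← AddSubgroup.index, hidx]
    exact hp.out.ne_zero
  have hP₀N : (QuotientAddGroup.mk P₀ : (W.baseChange (v.adicCompletion ℚ)).toAffine.Point ⧸ N) ≠ 0 := by
    intro h
    rw [QuotientAddGroup.eq_zero_iff] at h
    obtain ⟨S, hS⟩ := h
    exact hP₀ S hS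
  have hgen : AddSubgroup.zmultiples
      (QuotientAddGroup.mk P₀ : (W.baseChange (v.adicCompletion ℚ)).toAffine.Point ⧸ N) = ⊤ := by
    have hcard : Nat.card ((W.baseChange (v.adicCompletion ℚ)).toAffine.Point ⧸ N) = p := by
      rw [← AddSubgroup.index, hidx]
    have hdvd := (AddSubgroup.zmultiples
      (QuotientAddGroup.mk P₀ : (W.baseChange (v.adicCompletion ℚ)).toAffine.Point ⧸ N)).card_addSubgroup_dvd_card
    rw [hcard, Nat.dvd_prime hp.out] at hdvd
    rcases hdvd with h1 | hpq
    · exact absurd (AddSubgroup.eq_bot_of_card_eq _ h1)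
        (fun hbot ↦ hP₀N ((AddSubgroup.eq_bot_iff_forall _).1 hbot _ (AddSubgroup.mem_zmultiples _)))
    · exact AddSubgroup.eq_top_of_card_eq _ (by rw [hpq, hcard])
  intro P
  have hPmem : (QuotientAddGroup.mk P : (W.baseChange (v.adicCompletion ℚ)).toAffine.Point ⧸ N) ∈
      AddSubgroup.zmultiples (QuotientAddGroup.mk P₀ : (W.baseChange (v.adicCompletion ℚ)).toAffine.Point ⧸ N) := by
    rw [hgen]; exact AddSubgroup.mem_top _
  obtain ⟨k, hk⟩ := AddSubgroup.mem_zmultiples_iff.mp hPmem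
  have hdiff : P - k • P₀ ∈ N := by
    rw [← QuotientAddGroup.eq_zero_iff, QuotientAddGroup.mk_sub, QuotientAddGroup.mk_zsmul]
    exact sub_eq_zero.mpr hk.symm
  obtain ⟨S, hS⟩ := hdiff
  change p • S = P - k • P₀ at hS
  set jS : localPoints W (v.adicCompletion ℚ) := Affine.Point.map (W' := W)
    (IsScalarTower.toAlgHom ℚ (v.adicCompletion ℚ) (AlgebraicClosure (v.adicCompletion ℚ))) S with hjS
  refine ⟨k • R₀ + jS, ?_, fun σ ↦ ?_⟩
  · have hS' : k • P₀ + (p : ℤ) • S = P := by rw [natCast_zsmul, hS]; abel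
    have h2 := congrArg (Affine.Point.map (W' := W)
      (IsScalarTower.toAlgHom ℚ (v.adicCompletion ℚ) (AlgebraicClosure (v.adicCompletion ℚ)))) hS'
    rw [map_add, map_zsmul, map_zsmul] at h2
    rw [zsmul_add, smul_comm, hR₀, hjS]
    exact h2
  · obtain ⟨t, htΦ, ht⟩ := hR₀Φ σ
    refine ⟨k • t, Φ.toAddSubgroup.zsmul_mem htΦ k, ?_⟩
    rw [smul_add, smul_eq_of_eq_map_toAlgHom W (v.adicCompletion ℚ) σ S jS hjS, smul_comm, AddSubgroup.coe_zsmul,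
      map_zsmul, ← ht, zsmul_sub]
    abel

/-- **w2 g9's dichotomy on `Sel_p(W/ℚ)`, through the local one.** `W(ℚ_v)[p] = 0` and `Φ.Quot^{D_p} = 0` ⟹ ALIGNED ∨
TRANSVERSE (the statement of `SelmerCount.aligned_or_transverse_selmerGroup`, re-derived from §1–§2: the case is
decided by the pair `(W(ℚ_v), Φ)` alone, not by the Selmer group). [cite: MilneADT2006, I Lemma 3.3]
[cite: SilvermanAEC2009, X.§4 (diagram (**), Rem. 4.7)] -/
theorem aligned_or_transverse_selmerGroup_local (hpv : ((p : ℕ) : 𝓞 ℚ) ∈ v.asIdeal)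
    (htors : Nat.card (nsmulAddMonoidHom p :
      (W.baseChange (v.adicCompletion ℚ)).toAffine.Point →+ _).ker = 1)
    (hQD : ∀ q : Φ.Quot, (∀ g ∈ decomp v, g • q = q) → q = 0) :
    (∀ z : contOneCocycles (discreteTopRep (absoluteGaloisGroup ℚ) (geomTorsion W (p : ℤ))),
        oneCocycleClass _ z ∈ selmerGroup W (p : ℤ) →
          ∃ q : Φ.Quot, ∀ g ∈ decomp v, Φ.proj (z.1 g) = g • q - q) ∨
      ∀ w : contOneCocycles (discreteTopRep (absoluteGaloisGroup ℚ) Φ.Sub),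
        oneCocycleClass (discreteTopRep (absoluteGaloisGroup ℚ) (geomTorsion W (p : ℤ)))
          (contOneCocycles.pullback (ContinuousMonoidHom.id _)
            (resHomOfEquivariant (ContinuousMonoidHom.id _) Φ.incl Φ.incl_smul) w) ∈ selmerGroup W (p : ℤ) →
          ∃ s : Φ.Sub, ∀ g ∈ decomp v, w.1 g = g • s - s := by
  rcases forall_exists_adaptedRoot_or_forall_imp W v Φ hpv htors with hLA | hLT
  · exact Or.inl fun z hz ↦ aligned_of_forall_exists_adaptedRoot W v Φ hLA z hz
  · exact Or.inr fun w hw ↦ transverse_of_forall_exists_adaptedRoot_imp W v Φ hQD hLT w hw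

end Dichotomy

end Summit.BirchSwinnertonDyer.BirchSwinnertonDyer.Theorems.PrintCFram.SelmerCount

end
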